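import Summits.ValiantsHypothesis.ValiantsHypothesis.Theorems.TwistedDetRankSliceVBPFermionicFermionants

/-!
# Crux `TwistedDetRank.SliceVBPFermionic` (stmt-ValiantsHypothesis-17991, X2b) — the last falsifier
# of the census, `D^even_n = Σ_{σ : all cycles even} sgn σ · X^σ`: definition and parity lemmas

The first prover's falsifier census (Cruxes/SliceVBPFermionic/CALIBRATION.md §3) left exactly one
candidate against X2b neither `VNP ⊄ VBP`-hard nor with a twisted-rank lower bound: the class
function `sgn · [every cycle even]`, whose GMF is `D^even_n` ("tdr-blind: no lower bound, no
algorithm").  This file names it (`dEvenClass`, generic in the index type so that it transports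
along equivalences) and proves the parity facts both sequel files use:

* `dEvenClass_conj`, `dEvenClass_permCongr`: a class function, invariant under transport;
* `exists_pow_apply_eq_self_of_mem_cycleType`: a cycle length `l` is witnessed by a point of
  period dividing `l`;
* `allEven_iff_forall_odd_pow`: "no fixed point and all cycle lengths even" iff NO ODD POWER of
  the permutation has a fixed point — the form in which evenness is checked on block permutations
  (sequel `…DEvenTdr`) and on the covers of the layer-switch gadget (sequel `…DEvenHard`);
* `allEven_of_antiInvariant`: a permutation admitting a `2`-colouring `s ∘ σ = ¬ s` has all cycles
  even (`bool_pow_apply`: `s (σ^n x) = s x` xor `n` odd);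
* `dEvenClass_eq_sign_of_antiInvariant`, `dEvenClass_eq_zero_of_pow_apply_eq_self`: the two
  evaluations of the coefficient used by the gadget (layer-switch covers carry a `2`-colouring;
  a cover closing a `3`-cycle is killed).

HONEST FRAMING.  Census work on the refutation side of X2b; X2b itself is ≥ `VNP ⊄ VBP`
(Theorems/TwistedDetRankSliceVBPFermionicCalibration.lean) and is neither proved nor refuted here.
`VP ≠ VNP` is not moved by this item.

References: S. Mertens, C. Moore, Theory of Computing 9 (2013) 273–282, §1 (cycle-format
amplitudes); P. Bürgisser, *Completeness and Reduction in Algebraic Complexity Theory* (2000)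
§2.5, Ch. 7; R. Curticapean, STOC 2021 (immanant dichotomy).  The `def` below is a proof gadget
naming the family, not a route object.
-/

-- single-conjunct layout: Sub = Summit, duplicated namespace component intended
set_option linter.dupNamespace false

noncomputable section

namespace Summit.ValiantsHypothesis.ValiantsHypothesis.Theorems.TwistedDetRankSliceVBPFermionic

open Equiv Equiv.Perm

section AllEven

variable {α β : Type*} [Fintype α] [DecidableEq α] [Fintype β] [DecidableEq β]

/-- THE EVEN-CYCLE INDICATOR CLASS FUNCTION `d(σ) = sgn σ · [σ has no fixed point and every cycle
of σ has even length]` — the coefficient function of `D^even = Σ_{σ : all cycles even} sgn σ X^σ`,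
the last surviving falsifier candidate of the X2b census ("tdr-blind").  Generic in the index type
(it transports along equivalences, `dEvenClass_permCongr`).  A proof gadget naming that family,
not a route object. [folklore] -/
def dEvenClass (σ : Perm α) : ℂ :=
  if (∀ x, σ x ≠ x) ∧ (∀ l ∈ σ.cycleType, Even l) then ((Perm.sign σ : ℤ) : ℂ) else 0

/-- Evaluation of `dEvenClass` on an all-even permutation. [folklore] -/
theorem dEvenClass_of_allEven {σ : Perm α} (h : (∀ x, σ x ≠ x) ∧ ∀ l ∈ σ.cycleType, Even l) :
    dEvenClass σ = ((Perm.sign σ : ℤ) : ℂ) := by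
  unfold dEvenClass
  rw [if_pos h]

/-- Evaluation of `dEvenClass` off the all-even permutations. [folklore] -/
theorem dEvenClass_of_not_allEven {σ : Perm α}
    (h : ¬ ((∀ x, σ x ≠ x) ∧ ∀ l ∈ σ.cycleType, Even l)) : dEvenClass σ = 0 := by
  unfold dEvenClass
  rw [if_neg h]

/-- `dEvenClass` is invariant under transport of structure along an equivalence of index types
(fixed points, cycle type and sign are). [folklore] -/
theorem dEvenClass_permCongr (e : α ≃ β) (σ : Perm α) :
    dEvenClass (e.permCongr σ) = dEvenClass σ := by
  unfold dEvenClass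
  have hfix : (∀ y, (e.permCongr σ) y ≠ y) ↔ ∀ x, σ x ≠ x := by
    constructor
    · intro h x hx
      apply h (e x)
      simp [Equiv.permCongr_apply, hx]
    · intro h y hy
      apply h (e.symm y)
      rw [Equiv.permCongr_apply] at hy
      simpa using congrArg e.symm hy
  rw [TwistedDetRankFermionicNormalForm.cycleType_permCongr, Perm.sign_permCongr]
  simp only [hfix]

/-- `dEvenClass` is a class function. [folklore] -/
theorem dEvenClass_conj {n : ℕ} (σ τ : Perm (Fin n)) :
    dEvenClass (τ * σ * τ⁻¹) = dEvenClass σ := by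
  rw [conj_eq_permCongr, dEvenClass_permCongr]

/-- The order of the cycle of a moved point is one of the cycle lengths. [folklore] -/
theorem card_support_cycleOf_mem_cycleType {σ : Perm α} {x : α} (hx : σ x ≠ x) :
    (σ.cycleOf x).support.card ∈ σ.cycleType := by
  rw [cycleType_def, Multiset.mem_map]
  refine ⟨σ.cycleOf x, ?_, rfl⟩
  rw [← Finset.mem_def, cycleOf_mem_cycleFactorsFinset_iff, mem_support]
  exact hx

/-- If `σ^n` fixes a moved point `x`, the length of the cycle of `x` divides `n`. [folklore] -/
theorem card_support_cycleOf_dvd_of_pow_apply_eq_self {σ : Perm α} {x : α} (hx : σ x ≠ x) {n : ℕ}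
    (h : (σ ^ n) x = x) : (σ.cycleOf x).support.card ∣ n := by
  have hc : IsCycle (σ.cycleOf x) := σ.isCycle_cycleOf hx
  have hcx : σ.cycleOf x x ≠ x := by rwa [cycleOf_apply_self]
  have h1 : (σ.cycleOf x) ^ n = 1 := (hc.pow_eq_one_iff' hcx).2 (by rw [cycleOf_pow_apply_self, h])
  rw [← hc.orderOf]
  exact orderOf_dvd_of_pow_eq_one h1

/-- Every cycle length `l` of `σ` is witnessed by a moved point `x` with `σ^l x = x`. [folklore] -/
theorem exists_pow_apply_eq_self_of_mem_cycleType {σ : Perm α} {l : ℕ} (hl : l ∈ σ.cycleType) :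
    ∃ x, σ x ≠ x ∧ (σ ^ l) x = x := by
  rw [cycleType_def, Multiset.mem_map] at hl
  obtain ⟨c, hc, rfl⟩ := hl
  have hc' : c ∈ σ.cycleFactorsFinset := hc
  have hcyc : IsCycle c := (mem_cycleFactorsFinset_iff.1 hc').1
  obtain ⟨x, hx⟩ := hcyc.nonempty_support
  have hσx : σ x ≠ x := mem_support.1 (mem_cycleFactorsFinset_support_le hc' hx)
  refine ⟨x, hσx, ?_⟩
  have hceq : c = σ.cycleOf x := cycle_is_cycleOf hx hc'
  change (σ ^ (Finset.card ∘ support) c) x = x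
  simp only [Function.comp_apply]
  rw [← cycleOf_pow_apply_self, ← hceq, ← hcyc.orderOf, pow_orderOf_eq_one, Perm.one_apply]

/-- **Parity characterisation.**  A permutation has no fixed point and only even cycle lengths iff
no odd power of it has a fixed point. [folklore] -/
theorem allEven_iff_forall_odd_pow (σ : Perm α) :
    ((∀ x, σ x ≠ x) ∧ ∀ l ∈ σ.cycleType, Even l) ↔
      ∀ (n : ℕ) (x : α), Odd n → (σ ^ n) x ≠ x := by
  constructor
  · rintro ⟨hfix, heven⟩ n x hn h
    have hdvd := card_support_cycleOf_dvd_of_pow_apply_eq_self (hfix x) h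
    have hodd : Odd (σ.cycleOf x).support.card := hn.of_dvd_nat hdvd
    exact (Nat.not_even_iff_odd.2 hodd) (heven _ (card_support_cycleOf_mem_cycleType (hfix x)))
  · intro h
    refine ⟨fun x hx => h 1 x odd_one (by rw [pow_one]; exact hx), fun l hl => ?_⟩
    obtain ⟨x, -, hx⟩ := exists_pow_apply_eq_self_of_mem_cycleType hl
    rcases Nat.even_or_odd l with hle | hlo
    · exact hle
    · exact absurd hx (h l x hlo)

omit [Fintype α] [DecidableEq α] in
/-- A `2`-colouring `s` with `s ∘ σ = ¬ s` alternates along powers: `s (σ^n x) = s x` for even `n`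
and `= ¬ s x` for odd `n`. [folklore] -/
theorem bool_pow_apply {σ : Perm α} {s : α → Bool} (hs : ∀ x, s (σ x) = !s x) (n : ℕ) (x : α) :
    s ((σ ^ n) x) = if Even n then s x else !s x := by
  induction n generalizing x with
  | zero => simp
  | succ n ih =>
    rw [pow_succ', Perm.mul_apply, hs, ih]
    by_cases hn : Even n
    · have hn1 : ¬ Even (n + 1) := by rw [Nat.even_add_one]; exact not_not.2 hn
      rw [if_pos hn, if_neg hn1]
    · have hn1 : Even (n + 1) := by rw [Nat.even_add_one]; exact hn
      rw [if_neg hn, if_pos hn1, Bool.not_not]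

/-- **A permutation admitting a `2`-colouring `s ∘ σ = ¬ s` has no fixed point and all cycles
even** (an odd power would return the colour flipped). [folklore] -/
theorem allEven_of_antiInvariant {σ : Perm α} (s : α → Bool) (hs : ∀ x, s (σ x) = !s x) :
    (∀ x, σ x ≠ x) ∧ ∀ l ∈ σ.cycleType, Even l := by
  rw [allEven_iff_forall_odd_pow]
  intro n x hn h
  have h1 := bool_pow_apply hs n x
  rw [h, if_neg (Nat.not_even_iff_odd.2 hn)] at h1
  cases hsx : s x <;> simp [hsx] at h1

/-- On a permutation carrying a `2`-colouring the coefficient is the sign. [folklore] -/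
theorem dEvenClass_eq_sign_of_antiInvariant {σ : Perm α} (s : α → Bool)
    (hs : ∀ x, s (σ x) = !s x) : dEvenClass σ = ((Perm.sign σ : ℤ) : ℂ) :=
  dEvenClass_of_allEven (allEven_of_antiInvariant s hs)

/-- A permutation with a point of odd period has coefficient `0` (used with period `3`: the
covers of the layer-switch gadget that return to the entry layer). [folklore] -/
theorem dEvenClass_eq_zero_of_pow_apply_eq_self {σ : Perm α} {n : ℕ} (hn : Odd n) {x : α}
    (h : (σ ^ n) x = x) : dEvenClass σ = 0 := by
  apply dEvenClass_of_not_allEven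
  rw [allEven_iff_forall_odd_pow]
  exact fun hall => hall n x hn h

/-- The GMF `D^even_n` vanishes for no reason of degree: its coefficient function is supported on
fixed-point-free permutations, so in particular `dEvenClass 1 = 0` on a nonempty index type.
[folklore] -/
theorem dEvenClass_one [Nonempty α] : dEvenClass (1 : Perm α) = 0 := by
  obtain ⟨x⟩ := ‹Nonempty α›
  exact dEvenClass_eq_zero_of_pow_apply_eq_self odd_one (x := x) (by simp)

end AllEven

end Summit.ValiantsHypothesis.ValiantsHypothesis.Theorems.TwistedDetRankSliceVBPFermionic

end
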